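import Summits.BirchSwinnertonDyer.BirchSwinnertonDyer.Theorems.Rank2Observatory2DescKillSig12Defs
import HarnessLib

/-!
# KERNEL-2DESC — the SIGNATURE kill certificate `sig12rCheck` at an odd prime with ONE `ℤ_q`-root and a
# RAMIFIED quadratic place (rank-2 observatory, cert-1 gen 55; TIER 2r of `census/sigkill/SIGKILL-SPEC.md` §2/§5,
# design memo `census/places160-g54/DESIGN-TIER2R.md`)

HONEST FRAMING: per-curve certified theorems and census instruments; no claim on BSD in rank ≥ 2.
PARTITION: none — rank ≥ 2 data (N3); no r ≤ 1 cell claimed.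

Ramified twin of `Rank2Observatory2DescKillSig12Defs` (TIER 2u).  Here the field cubic factors over `ℤ_q` as
`g = (X − ε)·h`, `h = (X − r₁)² − D'` with `D' = q^{2k_d+1}·δ`, `q ∤ δ`: the quadratic place of `K = ℚ(α)` over `q`
is RAMIFIED, `K_𝔭 = ℚ_q(π')`, `π'² = q·δ`, and `α ↦ r₁ + q^{k_d}·π'`.  A zero `v = (r₀, r₁, r₂, n)` of `killQ` gives
`z·r² = w₀ − n²·T` in `ℤ[α]`; evaluating at `α ↦ ε` (integers mod `q^N`, `root_rel`) and at `α ↦ r₁ + q^{k_d}π'`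
(PAIRS `C + B·π'` mod `q^N`, the tier-2u `quad_rel` / `ev2_mul3` with `dl = q·δ` — they never used that the pair
parameter is a unit) gives one congruence in `ℤ/q^N` and one in pairs.  Square classes at the ramified place: an
element is `q^t·(C + Bπ')` with `(C, B)` `q`-primitive; its `π'`-valuation `2t + [q ∣ C]` is NEVER a tie between the
two coordinates, its class is (parity bit `[q ∣ C]`, Legendre bit of the LEADING coordinate — `C`, or `B` when
`q ∣ C` — twisted by `δ^t`, since `q^t = π'^{2t}·δ^{−t}`).  So the pair core lemma `coreRam` compares leading
coordinates directly (no norm form, no anisotropy: this is why the ramified case is simpler than `core2`), the index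
bound allows `v_q(h(ε)) = D₀ ≥ 0` (`q ∣ [𝓞_K : ℤ[α]]` happens at `q = 3` in the census: 68 of 168 kills), and the
disc walk `walkR` is `walk2` with the ramified reading `ramMis` of a decided quadratic centre (`C`-led iff
`v_q(y − E_C) ≤ k = v_q(E_B)`).  `sig12rCheck_sound` has the signature of `killCheck_sound`;
`killValidAt_of_sig12rCheck` drops into the validity-form rows like `killValidAt_of_sig12uCheck`.
Integers only; no `p`-adics, no `native_decide`.  Two implementations agree on the acceptance set
(`acls/TIER2R-TESTSET.jsonl`: 168/168 certified, and 857/857 one-root-ramified class slots of the A-class census agree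
with sigkill.py's exact verdicts, 0 false kills — Python mirror `sig12rlean.py`, cert-1 g55).

Structure: `sig12rCheck` COMPUTES the local data (cofactor `h₁, h₀`, `r₁ = −h₁/2`, `D' = q^{2k_d}·(qδ)`,
`h(ε) = q^{D₀}·H_u`, root data `ρ = (e₁, s₁, u₁) = rootData`, pair data `ev2 z = q^{s₂}·U` with `U` primitive, centre
`ev2 (0, t₁, t₂) = (E_C, q^k B_u)`) and `sig12rCore` DECIDES the conditions on it; `sig12rCore_sound` (part 3) proves
that no `q`-primitive zero of `killQ` exists.  SPLIT (gate lint «Theorems files ≤ 400 lines»): part 1 `…Sig12RDefs`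
(this file: `ramE` / `ramU` / `ramBit` / `ramMis` / `walkR`, `sig12rCore`, `sig12rCheck`), part 2 `…Sig12RCore` (`usq_decompR`,
`coreRam`, `ramMis_sound`, `walkR_sound`, `kill_scaledR`), part 3 `…Sig12R` (`indexR`, `val_boundR`, `ratR`,
`sig12rCore_sound`, `sig12rCheck_sound`, `killValidAt_of_sig12rCheck`).  Lands after the tier-2u files (imports them).
[cite: Cassels1991LecturesEllipticCurves, §15] [cite: CremonaAlgorithms1997, §3.6]
-/

-- single-conjunct summit: `Summit.BirchSwinnertonDyer.BirchSwinnertonDyer.…` repeats the name by design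
set_option linter.dupNamespace false

namespace Summit.BirchSwinnertonDyer.BirchSwinnertonDyer.Rank2Observatory.TwoDescKill

/-! ### Square-class reading of pairs `C + B·π'`, `π'² = q·δ` -/

/-- The `π'`-coordinate LEADS (`q ∣ C`): odd valuation at the ramified place for a `q`-primitive pair. [folklore] -/
def ramE (q : ℕ) (V : ℤ × ℤ) : Bool := decide (V.1 % (q : ℤ) = 0)

/-- The leading coordinate of a pair: `C`, or `B` when `q ∣ C` (a unit when the pair is `q`-primitive). [folklore] -/
def ramU (q : ℕ) (V : ℤ × ℤ) : ℤ := if V.1 % (q : ℤ) = 0 then V.2 else V.1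

/-- The Euler bit of `u₂·δ^{n mod 2}` from the two precomputed bits `l0 = bit(u₂)`, `l1 = bit(u₂·δ)`. [folklore] -/
def ramBit (l0 l1 : Bool) (n : ℕ) : Bool := if n % 2 = 0 then l0 else l1

/-- `ramBit` of the two precomputed bits is the Euler bit of `u·δ^{n mod 2}`. [folklore] -/
theorem ramBit_eq (q : ℕ) (u dlt : ℤ) (n : ℕ) :
    ramBit (eulerBit q u) (eulerBit q (u * dlt)) n = eulerBit q (u * dlt ^ (n % 2)) := by
  unfold ramBit
  split_ifs with h
  · rw [h, pow_zero, mul_one]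
  · have h1 : n % 2 = 1 := by omega
    rw [h1, pow_one]

/-- `ramE` / `ramU` of a pair whose first coordinate is a unit. [folklore] -/
theorem ramE_of_not_dvd {q : ℕ} {V : ℤ × ℤ} (h : ¬ (q : ℤ) ∣ V.1) : ramE q V = false ∧ ramU q V = V.1 := by
  have h' : ¬ V.1 % (q : ℤ) = 0 := fun e => h (Int.dvd_of_emod_eq_zero e)
  simp [ramE, ramU, h']

/-- `ramE` / `ramU` of a pair whose first coordinate is divisible by `q`. [folklore] -/
theorem ramE_of_dvd {q : ℕ} {V : ℤ × ℤ} (h : (q : ℤ) ∣ V.1) : ramE q V = true ∧ ramU q V = V.2 := by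
  have h' : V.1 % (q : ℤ) = 0 := Int.emod_eq_zero_of_dvd h
  simp [ramE, ramU, h']

/-! ### The checker -/

/-- Decided AND mismatching the class signature `(e₂; l0, l1; s₂)` at the RAMIFIED place on the disc `c + q^j ℤ_q`
(`k = v_q(E_B)`, `Bp ≡ E_B/q^k`): when `v_q(c − E_C) < j` and `≤ k` the element `(y − E_C) − E_B π'` is `C`-led with
leading unit the unit part of `c − E_C` and exponent `v_q(c − E_C)`; otherwise (decided) it is `π'`-led with leading
unit `−Bp` and exponent `k`. [folklore] -/
def ramMis (q : ℕ) (k : ℕ) (Bp EC : ℤ) (s₂ : ℕ) (e₂ l0 l1 : Bool) (c : ℤ) (j : ℕ) : Bool :=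
  let d := c - EC
  let sp := splitPow q j d
  quadDecided q k EC c j &&
    (decide (d % ((q ^ j : ℕ) : ℤ) = 0) || !decide (sp.2 % (q : ℤ) = 0)) &&
    (if ¬ d % ((q ^ j : ℕ) : ℤ) = 0 ∧ sp.1 ≤ k then
        (e₂ || !decide (eulerBit q sp.2 = ramBit l0 l1 (s₂ + sp.1)))
      else (!e₂ || !decide (eulerBit q (-Bp) = ramBit l0 l1 (s₂ + k))))

/-- The disc walk of TIER 2r: a node (disc `c + q^j ℤ_q` of `y`) is certified when the precision guard `j + B < N`
holds and either a decided place mismatches, or the quadratic centre is still undecided and all `q` children are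
certified (verbatim `walk2` with `ramMis` for `quadMis`). [folklore] -/
def walkR (q : ℕ) (ρ : ℤ × ℕ × ℤ) (k : ℕ) (Bp EC : ℤ) (s₂ : ℕ) (e₂ l0 l1 : Bool) (B N : ℕ) :
    ℕ → ℤ → ℕ → Bool
  | 0, c, j => decide (j + B < N) && (outMis q c j ρ || ramMis q k Bp EC s₂ e₂ l0 l1 c j)
  | f + 1, c, j => decide (j + B < N) &&
      (outMis q c j ρ || ramMis q k Bp EC s₂ e₂ l0 l1 c j ||
        (!quadDecided q k EC c j &&
          (List.range q).all fun d => walkR q ρ k Bp EC s₂ e₂ l0 l1 B N f (c + (d : ℤ) * ((q ^ j : ℕ) : ℤ)) (j + 1)))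

/-- The decided CONDITIONS of the TIER-2r certificate on precomputed data (see `sig12rCheck` for the data):
`q` odd; `g(ε) ≡ 0` (as `c + ε·h₀ ≡ 0`); `2r₁ ≡ −h₁`; `D' = q^{2k_d}·(q·δ)` with `δ` a unit; `h(ε) ≡ q^{D₀}·H_u` with
`H_u` a unit; `u₁` a unit; `(Z_C, Z_B) = q^{s₂}·(U_C, U_B)` with `U` `q`-primitive; `E_B = q^k·B_u`, `B_u` a unit; the
class is not RAT-like (`e₂ = false` with `bit(u₁) = bit(u₂·δ^{s₁+s₂})` is refused); the disc walk from `(0, 0)` with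
guard offset `max(s₁, s₂ + 2k_d + 1) + 2D₀`. [folklore] -/
def sig12rCore (q N : ℕ) (c ε h₁ h₀ r₁ Dp dlt : ℤ) (kd : ℕ) (He : ℤ) (D₀ : ℕ) (Hu : ℤ) (ρ : ℤ × ℕ × ℤ)
    (ZC ZB : ℤ) (s₂ : ℕ) (UC UB EC EB : ℤ) (k : ℕ) (Bu : ℤ) : Bool :=
  let M : ℤ := ((q ^ N : ℕ) : ℤ)
  let e₂ := ramE q (UC, UB)
  let u₂ := ramU q (UC, UB)
  let l0 := eulerBit q u₂
  let l1 := eulerBit q (u₂ * dlt)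
  decide (q % 2 = 1) &&
  decide ((c + ε * h₀) % M = 0) && decide ((2 * r₁ + h₁) % M = 0) &&
  decide (Dp = ((q ^ (2 * kd) : ℕ) : ℤ) * ((q : ℤ) * dlt)) && unitOK q dlt &&
  decide (He = ((q ^ D₀ : ℕ) : ℤ) * Hu) && unitOK q Hu &&
  unitOK q ρ.2.2 &&
  decide (ZC = ((q ^ s₂ : ℕ) : ℤ) * UC) && decide (ZB = ((q ^ s₂ : ℕ) : ℤ) * UB) &&
  !(decide (UC % (q : ℤ) = 0) && decide (UB % (q : ℤ) = 0)) &&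
  decide (EB = ((q ^ k : ℕ) : ℤ) * Bu) && unitOK q Bu &&
  !(!e₂ && decide (eulerBit q ρ.2.2 = ramBit l0 l1 (ρ.2.1 + s₂))) &&
  walkR q ρ k (Bu % (q : ℤ)) EC s₂ e₂ l0 l1 (max ρ.2.1 (s₂ + 2 * kd + 1) + 2 * D₀) N N 0 0

/-- **The TIER-2r certificate check** at the prime `q` for the class `z`, `θ`-coordinates `(t₁, t₂)`, field cubic
`X³ + aX² + bX + c`, precision `N` and the `ℤ_q`-root `ε` (mod `q^N`): computes the cofactor data
`h₁, h₀, r₁ = −h₁/2, D' = r₁² − h₀ = q^{2k_d+1}·δ`, `h(ε) = (ε − r₁)² − D' = q^{D₀}·H_u`, the root data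
`ρ = (e₁, s₁, u₁)` (`rootData`), the pair data `Z₂ = ev2 z = q^{s₂}·(U_C, U_B)` (pair parameter `dl = q·δ`,
`m = q^{k_d}`), the centre `E = ev2 (0, t₁, t₂) = (E_C, q^k·B_u)`, and runs `sig12rCore`. [folklore] -/
def sig12rCheck (q : ℕ) (a b c : ℤ) (z : ℤ × ℤ × ℤ) (t₁ t₂ : ℤ) (N : ℕ) (ε : ℤ) : Bool :=
  let M : ℤ := ((q ^ N : ℕ) : ℤ)
  let h₁ := (a + ε) % M
  let h₀ := (b + ε * h₁) % M
  let r₁ := (-h₁ * ((M + 1) / 2)) % M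
  let Dp := (r₁ * r₁ - h₀) % M
  let sd := splitPow q N Dp
  let kd := sd.1 / 2
  let m : ℤ := ((q ^ kd : ℕ) : ℤ)
  let dl : ℤ := (q : ℤ) * sd.2
  let He := ((ε - r₁) ^ 2 - Dp) % M
  let sH := splitPow q N He
  let ρ := rootData q N z t₁ t₂ ε
  let ZC := (ev2 r₁ m dl z).1 % M
  let ZB := (ev2 r₁ m dl z).2 % M
  let sC := (splitPow q N ZC).1
  let sB := (splitPow q N ZB).1
  let s₂ := if ZC = 0 then sB else if ZB = 0 then sC else min sC sB
  let UC := ZC / ((q ^ s₂ : ℕ) : ℤ)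
  let UB := ZB / ((q ^ s₂ : ℕ) : ℤ)
  let EC := (ev2 r₁ m dl ((0 : ℤ), t₁, t₂)).1 % M
  let EB := (ev2 r₁ m dl ((0 : ℤ), t₁, t₂)).2 % M
  let sE := splitPow q N EB
  sig12rCore q N c ε h₁ h₀ r₁ Dp sd.2 kd He sH.1 sH.2 ρ ZC ZB s₂ UC UB EC EB sE.1 sE.2

end Summit.BirchSwinnertonDyer.BirchSwinnertonDyer.Rank2Observatory.TwoDescKill
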